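import Mathlib
import HarnessLib
import Summits.CriticalPhenomena.PercolationContinuityZ3.Theorems.PercLowPointHalfSpaceBoundaryTwoArmDecayStubCensusLevels
import Literature.Probability.Percolation.InsertionTolerance

/-!
# Crux `PercLowPointHalfSpace.BoundaryTwoArmDecay` (stmt-CriticalPhenomena-0911), line
# `staircase-bootstrap-floor-decoupling` — stub `stub_census`, part III: the staple (insertion tolerance)

Helper file for the registered stub `stub_census` (TRUNCATED LEVEL CENSUS `P(A_n ∧ K_n ≤ k) ≤ C·k·e_n`) of the
skeleton `Cruxes/BoundaryTwoArmDecay/Lines/staircase_bootstrap_floor_decoupling.lean`; lands with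
`--supports stmt-CriticalPhenomena-0911` (registered sub-goal `stub_census_halfSpaceLocal`). Definition-free; the
objects are those of `PercLowPointHalfSpaceBoundaryTwoArmDecayStubCensusDefs.lean`.

Write `U = C_ℍ(0)`, `V = C_{ℍ₋₁}(0)`, `J = J n 0 ω` (number of `n`-tall `ℍ`-clusters inside `V`),
`κ_n = kap n = E[1{U n-tall, U has a partner-kiss edge}/|U ∩ ∂ℍ|]`, `p = p_c(ℤ³)`.

* `stub_census_halfSpaceLocal` — events `{x ↔ y in ℍ}` are determined by the pairs of vertices of `ℍ`; hence the
  kissing weight `hsel n g` (`1/|U ∩ ∂ℍ|` on `{U n-tall, g is the selected (least) partner-kiss edge of U}`) is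
  measurable w.r.t. the states of those pairs (`measurable_hsel_edgeSigma`);
* `lintegral_staple_hsel` — **insertion tolerance**: the three-edge `staple g` under the floor edge `g` (through
  level `-1`) is disjoint from those pairs, so `p³ ∫ hsel_g ≤ ∫ 1{staple(g) open} hsel_g` (independence of
  disjoint edge sets, `bondPercolation_indep_edgeSigma`; `P(staple open) = p^{|staple|} ≥ p³`,
  `bondPercolation_real_setOf_subset`);
* `merge` — if `U` is `n`-tall, `g = (q₁, q₂)` a partner-kiss edge and the staple is open, then `V` is footed at
  level `-1` and `J ≥ 2` (the blocks of `U` and `C_ℍ(q₂)` each contribute `1`; BGN finiteness);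
  `one_le_J` — `J ≥ 1` on `{U n-tall}`;
* `kap_le_X` — summing over the selected edge (`κ_n = Σ_g ∫ hsel_g`, Tonelli twice):
  **`p³ κ_n ≤ X_n := ∫ 1{U n-tall, J ≥ 2, V footed}/|U ∩ ∂ℍ| dP`** (the staple bound).

Sources: B. Bollobás – O. Riordan, *Percolation* (2006), Ch. 5 Lemma 2 (insertion tolerance); G. Grimmett,
*Percolation* (1999), §1.3 (product measure), Thm. (7.35) (BGN).
-/

noncomputable section

namespace Summit.CriticalPhenomena.PercolationContinuityZ3.Theorems.BoundaryTwoArmDecay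

open MeasureTheory Filter Topology
open Literature.Probability.Percolation Literature.Probability.LatticeModels
open scoped ENNReal

/-- **Events about `ℍ`-clusters are determined by the pairs of vertices of `ℍ`** (registered sub-goal
`stub_census_halfSpaceLocal` of `stub_census`): restricting a configuration to the pairs inside `ℍ` does not
change any event `{x ↔ y in ℍ}` (`determinedBy_openConnVia` of `ConstrainedClusters.lean`). -/
theorem stub_census_halfSpaceLocal : ∀ (ω : BondConfig (Site 3)) (x y : Site 3),
    ω ∩ (withinGraph ⊤ (halfSpace 3)).edgeSet ∈ openConnIn (halfSpace 3) x y ↔ ω ∈ openConnIn (halfSpace 3) x y := by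
  intro ω x y
  by_cases hx : x ∈ halfSpace 3
  · rw [openConnIn_eq_openConnVia hx]
    have h := (determinedBy_iff _ _).1 (determinedBy_openConnVia (withinGraph ⊤ (halfSpace 3)) x y) ω
      (ω ∩ (withinGraph ⊤ (halfSpace 3)).edgeSet) (by rw [Set.inter_assoc, Set.inter_self])
    exact h.symm
  · constructor
    · exact fun h => (hx h.1).elim
    · exact fun h => (hx h.1).elim

namespace StubCensus

open LowPoint (conn_symm conn_trans conn_refl conn_mono conn_iff_mem_cluster lintegral_shift)
open Negative (μ)
open ProbabilityTheory

/-! ### Locality: the kissing weight depends only on the pairs inside `ℍ` -/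

/-- Restriction to `EH` does not change `{x ↔ y in ℍ}`. -/
theorem inter_EH_conn_iff (ω : BondConfig (Site 3)) (x y : Site 3) :
    ω ∩ EH ∈ openConnIn (halfSpace 3) x y ↔ ω ∈ openConnIn (halfSpace 3) x y :=
  stub_census_halfSpaceLocal ω x y

/-- Restriction to `EH` does not change tallness of `ℍ`-clusters. -/
theorem inter_EH_tall_iff (ω : BondConfig (Site 3)) (n : ℕ) (a : Site 3) :
    ω ∩ EH ∈ tall (halfSpace 3) n a ↔ ω ∈ tall (halfSpace 3) n a := by
  simp only [mem_tall, inter_EH_conn_iff]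

/-- Restriction to `EH` does not change `ℍ`-clusters. -/
theorem cl_inter_EH (ω : BondConfig (Site 3)) (a : Site 3) : cl (halfSpace 3) a (ω ∩ EH) = cl (halfSpace 3) a ω := by
  ext u
  exact inter_EH_conn_iff ω a u

/-- Restriction to `EH` does not change the partner-kiss edges. -/
theorem PK_inter_EH (ω : BondConfig (Site 3)) (n : ℕ) (a : Site 3) : PK n a (ω ∩ EH) = PK n a ω := by
  ext q
  simp only [PK, Set.mem_setOf_eq, inter_EH_conn_iff, inter_EH_tall_iff]

/-- Restriction to `EH` does not change the kissing weight. -/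
theorem hsel_inter_EH (n : ℕ) (g : Site 3 × Site 3) (ω : BondConfig (Site 3)) : hsel n g (ω ∩ EH) = hsel n g ω := by
  unfold hsel
  have hmem : (ω ∩ EH ∈ {ω' : BondConfig (Site 3) | ω' ∈ tall (halfSpace 3) n 0 ∧ g ∈ sel (PK n 0 ω')}) ↔
      ω ∈ {ω' : BondConfig (Site 3) | ω' ∈ tall (halfSpace 3) n 0 ∧ g ∈ sel (PK n 0 ω')} := by
    simp only [Set.mem_setOf_eq, inter_EH_tall_iff, PK_inter_EH]
  by_cases h : ω ∈ {ω' : BondConfig (Site 3) | ω' ∈ tall (halfSpace 3) n 0 ∧ g ∈ sel (PK n 0 ω')}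
  · rw [Set.indicator_of_mem (hmem.2 h), Set.indicator_of_mem h, fl, fl, cl_inter_EH]
  · rw [Set.indicator_of_notMem (fun h' => h (hmem.1 h')), Set.indicator_of_notMem h]

/-! ### Measurability of the kissing weight -/

/-- `{ω | g is the selected kiss edge}` is measurable. -/
theorem measurableSet_mem_sel_PK (n : ℕ) (g : Site 3 × Site 3) :
    MeasurableSet {ω : BondConfig (Site 3) | g ∈ sel (PK n 0 ω)} := by
  have h : {ω : BondConfig (Site 3) | g ∈ sel (PK n 0 ω)} = {ω | g ∈ PK n 0 ω} ∩
      ⋂ g' : Site 3 × Site 3, ({ω | g' ∈ PK n 0 ω}ᶜ ∪ {_ω | pairEnc g ≤ pairEnc g'}) := by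
    ext ω
    simp only [sel, Set.mem_setOf_eq, Set.mem_inter_iff, Set.mem_iInter, Set.mem_union, Set.mem_compl_iff]
    constructor
    · rintro ⟨hg, hmin⟩
      exact ⟨hg, fun g' => (em (g' ∈ PK n 0 ω)).elim (fun h' => Or.inr (hmin g' h')) Or.inl⟩
    · rintro ⟨hg, hmin⟩
      exact ⟨hg, fun g' hg' => (hmin g').resolve_left (not_not.2 hg')⟩
  rw [h]
  exact (measurableSet_mem_PK n 0 g).inter (MeasurableSet.iInter fun g' =>
    (measurableSet_mem_PK n 0 g').compl.union (MeasurableSet.const _))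

/-- The kissing weight is measurable. -/
theorem measurable_hsel (n : ℕ) (g : Site 3 × Site 3) : Measurable (hsel n g) := by
  have hset : {ω' : BondConfig (Site 3) | ω' ∈ tall (halfSpace 3) n 0 ∧ g ∈ sel (PK n 0 ω')} =
      tall (halfSpace 3) n 0 ∩ {ω' | g ∈ sel (PK n 0 ω')} := by
    ext ω
    simp only [Set.mem_setOf_eq, Set.mem_inter_iff]
  unfold hsel
  rw [hset]
  exact (measurable_fl_inv _ _ _).indicator ((measurableSet_tall _ _ _).inter (measurableSet_mem_sel_PK n g))

/-- The kissing weight is measurable with respect to the states of the pairs inside `ℍ`. -/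
theorem measurable_hsel_edgeSigma (n : ℕ) (g : Site 3 × Site 3) : Measurable[edgeSigma EH] (hsel n g) := by
  have h : hsel n g = (hsel n g) ∘ fun ω => ω ∩ EH := by
    funext ω
    exact (hsel_inter_EH n g ω).symm
  rw [h]
  exact (measurable_hsel n g).comp (measurable_inter_edgeSigma EH)

/-! ### Insertion tolerance: opening the staple costs `p_c³` -/

/-- **The staple is independent of the kissing weight**: for a floor lattice edge `g`,
`p_c³ ∫ hsel_g ≤ ∫ 1{staple(g) open} hsel_g` (independence of disjoint edge sets under the product measure,
`bondPercolation_indep_edgeSigma`, and `P(staple open) = p_c^{|staple|} ≥ p_c³`). -/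
theorem lintegral_staple_hsel (n : ℕ) (g : Site 3 × Site 3) :
    ENNReal.ofReal ((criticalProbI 3 : ℝ) ^ 3) * ∫⁻ ω, hsel n g ω ∂μ ≤
      ∫⁻ ω, {ω' : BondConfig (Site 3) | (↑(staple g) : Set (Sym2 (Site 3))) ⊆ ω'}.indicator
        (fun _ => (1 : ℝ≥0∞)) ω * hsel n g ω ∂μ := by
  by_cases hg : g.1 0 = 0 ∧ g.2 0 = 0 ∧ (zdGraph 3).Adj g.1 g.2
  · obtain ⟨h1, h2, hadj⟩ := hg
    have hSm : MeasurableSet {ω' : BondConfig (Site 3) | (↑(staple g) : Set (Sym2 (Site 3))) ⊆ ω'} :=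
      measurableSet_setOf_subset (staple g).countable_toSet
    have hSσ : MeasurableSet[edgeSigma (↑(staple g) : Set (Sym2 (Site 3)))]
        {ω' : BondConfig (Site 3) | (↑(staple g) : Set (Sym2 (Site 3))) ⊆ ω'} :=
      (determinedBy_setOf_subset _).measurableSet_edgeSigma hSm
    have hind : Measurable[edgeSigma (↑(staple g) : Set (Sym2 (Site 3)))]
        fun ω : BondConfig (Site 3) => {ω' : BondConfig (Site 3) |
          (↑(staple g) : Set (Sym2 (Site 3))) ⊆ ω'}.indicator (fun _ => (1 : ℝ≥0∞)) ω :=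
      Measurable.indicator measurable_const hSσ
    rw [lintegral_mul_eq_lintegral_mul_lintegral_of_independent_measurableSpace (edgeSigma_le _)
      (edgeSigma_le _) (bondPercolation_indep_edgeSigma (zdGraph 3) (criticalProbI 3)
      (disjoint_staple_EH h1 h2)) hind (measurable_hsel_edgeSigma n g)]
    gcongr
    rw [lintegral_indicator_const hSm, one_mul]
    have hreal : μ.real {ω' : BondConfig (Site 3) | (↑(staple g) : Set (Sym2 (Site 3))) ⊆ ω'} =
        (criticalProbI 3 : ℝ) ^ (staple g).card :=
      bondPercolation_real_setOf_subset (zdGraph 3) (criticalProbI 3) (staple g) (staple_subset_edgeSet hadj)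
    rw [← ENNReal.ofReal_toReal (measure_ne_top μ _), ← measureReal_def, hreal]
    refine ENNReal.ofReal_le_ofReal ?_
    exact pow_le_pow_of_le_one (criticalProbI 3).2.1 (criticalProbI 3).2.2 (card_staple_le g)
  · -- `g` is not a floor lattice edge: the kissing weight vanishes identically
    have h0 : ∀ ω, hsel n g ω = 0 := by
      intro ω
      unfold hsel
      refine Set.indicator_of_notMem (fun h => hg ?_) _
      obtain ⟨-, hgs⟩ := h
      have hgP := sel_subset _ hgs
      exact ⟨hgP.1, hgP.2.1, hgP.2.2.1⟩
    simp only [h0, lintegral_const, zero_mul, mul_zero]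
    exact le_rfl

/-! ### The kissing density as a sum over the selected kiss edge -/

/-- `Σ_g hsel_g(ω) = 1{U n-tall, PK ≠ ∅}/|U ∩ ∂ℍ|`: exactly one kiss edge is selected. -/
theorem tsum_hsel (n : ℕ) (ω : BondConfig (Site 3)) :
    ∑' g, hsel n g ω = {ω : BondConfig (Site 3) | ω ∈ tall (halfSpace 3) n 0 ∧ (PK n 0 ω).Nonempty}.indicator
      (fun ω => (((fl (halfSpace 3) 0 0 ω : ℕ∞) : ℝ≥0∞))⁻¹) ω := by
  by_cases h : ω ∈ tall (halfSpace 3) n 0 ∧ (PK n 0 ω).Nonempty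
  · obtain ⟨g₀, hg₀⟩ := sel_nonempty h.2
    rw [Set.indicator_of_mem (show ω ∈ {ω : BondConfig (Site 3) | ω ∈ tall (halfSpace 3) n 0 ∧
      (PK n 0 ω).Nonempty} from h), tsum_eq_single g₀]
    · unfold hsel
      rw [Set.indicator_of_mem (show ω ∈ {ω' : BondConfig (Site 3) | ω' ∈ tall (halfSpace 3) n 0 ∧
        g₀ ∈ sel (PK n 0 ω')} from ⟨h.1, hg₀⟩)]
    · intro g hg
      unfold hsel
      refine Set.indicator_of_notMem ?_ _
      rintro ⟨-, hg'⟩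
      exact hg (sel_subsingleton _ hg' hg₀)
  · rw [Set.indicator_of_notMem (show ω ∉ {ω : BondConfig (Site 3) | ω ∈ tall (halfSpace 3) n 0 ∧
      (PK n 0 ω).Nonempty} from h)]
    refine ENNReal.tsum_eq_zero.2 fun g => ?_
    unfold hsel
    refine Set.indicator_of_notMem ?_ _
    rintro ⟨ht, hg⟩
    exact h ⟨ht, g, sel_subset _ hg⟩

/-- `κ_n = Σ_g ∫ hsel_g`. -/
theorem kap_eq_tsum (n : ℕ) : kap n = ∑' g, ∫⁻ ω, hsel n g ω ∂μ := by
  rw [kap, ← lintegral_tsum fun g => (measurable_hsel n g).aemeasurable]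
  exact lintegral_congr fun ω => (tsum_hsel n ω).symm

/-! ### Opening the staple merges two `n`-tall `ℍ`-clusters -/

/-- A block of `J`: the floor points of one footed finite `ℍ`-cluster inside the support contribute exactly `1`. -/
theorem sum_block {T A : Set (Site 3)} {f : Site 3 → ℝ≥0∞} (hA : A.Finite) (hne : A.Nonempty) (hAT : A ⊆ T)
    (hf : ∀ γ ∈ A, f γ = ((((A.encard : ℕ∞) : ℝ≥0∞)))⁻¹) :
    ∑ γ ∈ hA.toFinset, T.indicator f γ = 1 := by
  have h1 : ∀ γ ∈ hA.toFinset, T.indicator f γ = ((((A.encard : ℕ∞) : ℝ≥0∞)))⁻¹ := by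
    intro γ hγ
    rw [Set.Finite.mem_toFinset] at hγ
    rw [Set.indicator_of_mem (hAT hγ), hf γ hγ]
  rw [Finset.sum_congr rfl h1, Finset.sum_const, nsmul_eq_mul, hA.encard_eq_coe_toFinset_card,
    ENat.toENNReal_coe]
  refine ENNReal.mul_inv_cancel ?_ (ENNReal.natCast_ne_top _)
  rw [Nat.cast_ne_zero, Finset.card_ne_zero]
  obtain ⟨γ, hγ⟩ := hne
  exact ⟨γ, hA.mem_toFinset.2 hγ⟩

/-- The floor of an `n`-tall `ℍ`-cluster `C_ℍ(a)` inside `C_{ℍ₋₁}(0)` is a block of `J n 0 ω`. -/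
theorem floor_subset_support {ω : BondConfig (Site 3)} {n : ℕ} {a : Site 3} (ha : a ∈ cl Hm 0 ω)
    (hta : ω ∈ tall (halfSpace 3) n a) :
    cl (halfSpace 3) a ω ∩ {u | u 0 = 0} ⊆
      {γ : Site 3 | γ 0 = 0 ∧ γ ∈ cl Hm 0 ω ∧ ω ∈ tall (halfSpace 3) n γ} := by
  rintro γ ⟨hγ, hγ0⟩
  exact ⟨hγ0, conn_trans ha (conn_mono halfSpace_subset_Hm hγ), (tall_iff_of_mem hγ).2 hta⟩

/-- On the floor of `C_ℍ(a)` the summand of `J` is `1/|C_ℍ(a) ∩ ∂ℍ|`. -/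
theorem summand_eq_on_floor {ω : BondConfig (Site 3)} {a : Site 3} :
    ∀ γ ∈ cl (halfSpace 3) a ω ∩ {u | u 0 = 0},
      (((fl (halfSpace 3) 0 γ ω : ℕ∞) : ℝ≥0∞))⁻¹ =
        ((((cl (halfSpace 3) a ω ∩ {u | u 0 = 0}).encard : ℕ∞) : ℝ≥0∞))⁻¹ := by
  rintro γ ⟨hγ, -⟩
  rw [fl_eq_of_mem hγ, fl]

/-- **`J ≥ 1` on `{U n-tall}`** (the block of `U` itself), on the good event. -/
theorem one_le_J {ω : BondConfig (Site 3)}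
    (hfin : ∀ v : Site 3, (halfSpaceCluster (BondConfig.relabel (sym2Equiv (Site.shift v)) ω)).Finite)
    {n : ℕ} (ht : ω ∈ tall (halfSpace 3) n 0) : 1 ≤ J n 0 ω := by
  have hA : (cl (halfSpace 3) 0 ω ∩ {u | u 0 = 0}).Finite :=
    (finite_cl_halfSpace hfin rfl).subset Set.inter_subset_left
  have hne : (cl (halfSpace 3) 0 ω ∩ {u | u 0 = 0}).Nonempty := ⟨0, self_mem_cl (zero_mem_halfSpace 3) ω, rfl⟩
  rw [← sum_block hA hne (floor_subset_support (self_mem_cl (halfSpace_subset_Hm (zero_mem_halfSpace 3)) ω) ht)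
    summand_eq_on_floor, J]
  exact ENNReal.sum_le_tsum _

/-- **Merging.** On the good event: if `U` is `n`-tall, `g = (q₁, q₂)` is a partner-kiss edge of `U` and the
staple under `g` is open, then `C_{ℍ₋₁}(0)` is footed at level `-1` and contains the two distinct `n`-tall
`ℍ`-clusters `U` and `C_ℍ(q₂)`, so `J ≥ 2`. -/
theorem merge {ω : BondConfig (Site 3)}
    (hfin : ∀ v : Site 3, (halfSpaceCluster (BondConfig.relabel (sym2Equiv (Site.shift v)) ω)).Finite)
    {n : ℕ} (ht : ω ∈ tall (halfSpace 3) n 0) {g : Site 3 × Site 3} (hg : g ∈ PK n 0 ω)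
    (hst : (↑(staple g) : Set (Sym2 (Site 3))) ⊆ ω) :
    0 < fl Hm (-1) 0 ω ∧ 2 ≤ J n 0 ω := by
  obtain ⟨h1, h2, hadj, hq1, hq2, ht2⟩ := hg
  have he1 : s(g.1, g.1 - e₀) ∈ ω := hst (by simp [staple])
  have he2 : s(g.1 - e₀, g.2 - e₀) ∈ ω := hst (by simp [staple])
  have he3 : s(g.2 - e₀, g.2) ∈ ω := hst (by simp [staple])
  have hne0 : (e₀ : Site 3) ≠ 0 := by
    intro h
    have := congrFun h 0
    simp [e₀] at this
  have c1 : ω ∈ openConnIn Hm 0 (g.1 - e₀) :=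
    conn_step (conn_mono halfSpace_subset_Hm hq1) he1 (fun h => hne0 (sub_eq_self.1 h.symm))
      (show -1 ≤ (g.1 - e₀) 0 by simp [e₀, h1])
  have c2 : ω ∈ openConnIn Hm 0 (g.2 - e₀) := by
    refine conn_step c1 he2 (fun h => hadj.ne (sub_left_inj.1 h)) ?_
    show -1 ≤ (g.2 - e₀) 0
    simp [e₀, h2]
  have c3 : ω ∈ openConnIn Hm 0 g.2 :=
    conn_step c2 he3 (fun h => hne0 (sub_eq_self.1 h)) (show -1 ≤ g.2 0 by omega)
  refine ⟨Set.encard_pos.2 ⟨g.1 - e₀, c1, show (g.1 - e₀) 0 = -1 by simp [e₀, h1]⟩, ?_⟩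
  -- the two blocks
  set A : Set (Site 3) := cl (halfSpace 3) 0 ω ∩ {u | u 0 = 0} with hAdef
  set B : Set (Site 3) := cl (halfSpace 3) g.2 ω ∩ {u | u 0 = 0} with hBdef
  have hA : A.Finite := (finite_cl_halfSpace hfin rfl).subset Set.inter_subset_left
  have hB : B.Finite := (finite_cl_halfSpace hfin h2).subset Set.inter_subset_left
  have hAne : A.Nonempty := ⟨0, self_mem_cl (zero_mem_halfSpace 3) ω, rfl⟩
  have hBne : B.Nonempty := ⟨g.2, self_mem_cl (show 0 ≤ g.2 0 by omega) ω, h2⟩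
  have hdisj : Disjoint hA.toFinset hB.toFinset := by
    rw [Finset.disjoint_left]
    intro γ hγA hγB
    rw [Set.Finite.mem_toFinset] at hγA hγB
    have hγ2 : g.2 ∈ cl (halfSpace 3) γ ω := conn_symm hγB.1
    rw [cl_eq_of_mem hγA.1] at hγ2
    exact hq2 hγ2
  have hsumA := sum_block hA hAne (floor_subset_support (self_mem_cl (halfSpace_subset_Hm
    (zero_mem_halfSpace 3)) ω) ht) summand_eq_on_floor
  have hsumB := sum_block hB hBne (floor_subset_support c3 ht2) summand_eq_on_floor
  calc (2 : ℝ≥0∞) = 1 + 1 := by norm_num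
    _ = ∑ γ ∈ hA.toFinset ∪ hB.toFinset, {γ : Site 3 | γ 0 = 0 ∧ γ ∈ cl Hm 0 ω ∧
          ω ∈ tall (halfSpace 3) n γ}.indicator (fun γ => (((fl (halfSpace 3) 0 γ ω : ℕ∞) : ℝ≥0∞))⁻¹) γ := by
        rw [Finset.sum_union hdisj, hsumA, hsumB]
    _ ≤ J n 0 ω := ENNReal.sum_le_tsum _

/-! ### The staple bound `p_c³ κ_n ≤ X_n` -/

/-- **The staple bound.** `p_c³ κ_n ≤ X_n := ∫ 1{U n-tall, J ≥ 2, C_{ℍ₋₁}(0) footed}/|U ∩ ∂ℍ| dP`. -/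
theorem kap_le_X (n : ℕ) : ENNReal.ofReal ((criticalProbI 3 : ℝ) ^ 3) * kap n ≤
    ∫⁻ ω, {ω : BondConfig (Site 3) | ω ∈ tall (halfSpace 3) n 0 ∧ 2 ≤ J n 0 ω ∧ 0 < fl Hm (-1) 0 ω}.indicator
      (fun ω => (((fl (halfSpace 3) 0 0 ω : ℕ∞) : ℝ≥0∞))⁻¹) ω ∂μ := by
  have hmeas : ∀ g : Site 3 × Site 3, Measurable fun ω : BondConfig (Site 3) =>
      {ω' : BondConfig (Site 3) | (↑(staple g) : Set (Sym2 (Site 3))) ⊆ ω'}.indicator (fun _ => (1 : ℝ≥0∞)) ω *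
        hsel n g ω := fun g =>
    (measurable_const.indicator (measurableSet_setOf_subset (staple g).countable_toSet)).mul (measurable_hsel n g)
  calc ENNReal.ofReal ((criticalProbI 3 : ℝ) ^ 3) * kap n
      = ∑' g, ENNReal.ofReal ((criticalProbI 3 : ℝ) ^ 3) * ∫⁻ ω, hsel n g ω ∂μ := by
        rw [kap_eq_tsum, ENNReal.tsum_mul_left]
    _ ≤ ∑' g, ∫⁻ ω, {ω' : BondConfig (Site 3) | (↑(staple g) : Set (Sym2 (Site 3))) ⊆ ω'}.indicator
          (fun _ => (1 : ℝ≥0∞)) ω * hsel n g ω ∂μ := ENNReal.tsum_le_tsum fun g => lintegral_staple_hsel n g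
    _ = ∫⁻ ω, ∑' g, {ω' : BondConfig (Site 3) | (↑(staple g) : Set (Sym2 (Site 3))) ⊆ ω'}.indicator
          (fun _ => (1 : ℝ≥0∞)) ω * hsel n g ω ∂μ := (lintegral_tsum fun g => (hmeas g).aemeasurable).symm
    _ ≤ _ := by
        refine lintegral_mono_ae ?_
        filter_upwards [ae_good] with ω hω
        by_cases h : ω ∈ tall (halfSpace 3) n 0 ∧ (PK n 0 ω).Nonempty
        · obtain ⟨g₀, hg₀⟩ := sel_nonempty h.2
          rw [tsum_eq_single g₀]
          · by_cases hst : (↑(staple g₀) : Set (Sym2 (Site 3))) ⊆ ω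
            · obtain ⟨hfoot, hJ⟩ := merge hω.2 h.1 (sel_subset _ hg₀) hst
              rw [Set.indicator_of_mem (show ω ∈ {ω' : BondConfig (Site 3) |
                (↑(staple g₀) : Set (Sym2 (Site 3))) ⊆ ω'} from hst), one_mul,
                Set.indicator_of_mem (show ω ∈ {ω : BondConfig (Site 3) | ω ∈ tall (halfSpace 3) n 0 ∧
                  2 ≤ J n 0 ω ∧ 0 < fl Hm (-1) 0 ω} from ⟨h.1, hJ, hfoot⟩)]
              unfold hsel
              rw [Set.indicator_of_mem (show ω ∈ {ω' : BondConfig (Site 3) | ω' ∈ tall (halfSpace 3) n 0 ∧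
                g₀ ∈ sel (PK n 0 ω')} from ⟨h.1, hg₀⟩)]
            · rw [Set.indicator_of_notMem (show ω ∉ {ω' : BondConfig (Site 3) |
                (↑(staple g₀) : Set (Sym2 (Site 3))) ⊆ ω'} from hst), zero_mul]
              exact bot_le
          · intro g hg
            unfold hsel
            rw [Set.indicator_of_notMem (show ω ∉ {ω' : BondConfig (Site 3) | ω' ∈ tall (halfSpace 3) n 0 ∧
              g ∈ sel (PK n 0 ω')} from fun h' => hg (sel_subsingleton _ h'.2 hg₀)), mul_zero]
        · have h0 : ∀ g, {ω' : BondConfig (Site 3) | (↑(staple g) : Set (Sym2 (Site 3))) ⊆ ω'}.indicator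
              (fun _ => (1 : ℝ≥0∞)) ω * hsel n g ω = 0 := by
            intro g
            unfold hsel
            rw [Set.indicator_of_notMem (show ω ∉ {ω' : BondConfig (Site 3) | ω' ∈ tall (halfSpace 3) n 0 ∧
              g ∈ sel (PK n 0 ω')} from fun h' => h ⟨h'.1, g, sel_subset _ h'.2⟩), mul_zero]
          rw [ENNReal.tsum_eq_zero.2 h0]
          exact bot_le

end StubCensus

end Summit.CriticalPhenomena.PercolationContinuityZ3.Theorems.BoundaryTwoArmDecay

end
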